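import Summits.HubbardSuperconductivity.HubbardLadder.Bounds.ThermalAttractiveStiffnessCeiling

/-!
# Hubbard ladder — Bounds: the TIGHT attractive ceilings at `T > 0` with ONE entropy term
# (bounds.tex Thm 8♯(v) and its stiffness form, pure Hubbard torus, typed AND proved)

HONEST FRAMING (cell pub-hubbard): ladder R1–R4 with certified numbers; no claim on H/H₀. These
are bounds for a MODEL CLASS — the attractive Hubbard torus `hubbardTorusTT' L 1 0 U`
(`= hubbardTorus 2 L 1 U`; `t = 1`, `t' = 0`, `U < 0`, torus `(ℤ/Lℤ)²`, `L ≥ 4` even) in the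
canonical `(2m, S^z = 0)` Gibbs state at `β > 0`, for a stiffness DEFINED from the flux response
of the sector free energy; no materials claim. Companion text: `pub-hubbard/paper/bounds.tex`
§Theorem 8♯; tables `pub-hubbard/pub-hubbard-bounds/BOUNDS.md` (row T6♯) and `EXTREMISERS.md` §5a♯.

## What is proved (no `sorry`, no new axioms), `N_p := dim` of the sector

* `le_re_gibbsState_toBlock_of_le_groundEnergy` — generic: for a Hermitian `M` on a fermionic
  Fock space, every `E ≤ E₀(M; N)` (the `N`-particle variational ground energy), every coordinate
  sector `p` of `N`-particle configurations and every sector Gibbs state `⟨·⟩_{β, A|_p}`: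
  `E ≤ Re⟨M|_p⟩_{β, A|_p}` — `(M - E·1)|_p ≥ 0` (the homogeneous variational principle
  `LiebThm1.groundEnergy_mul_norm_le` on extensions by zero) and Gibbs positivity.
* `neg_re_gibbsState_hopping_le_attractive_sharp` — **Thm 8♯(v), tree form** (`L ≥ 4` even,
  `U < 0`, `β > 0`, `m ≤ L²`, `p ∋` every paired configuration, `p ⊆ {|s| = 2m}`):
  `⟨-T⟩_{β,p} = -Re⟨H(0)|_p⟩_{β,p} ≤ 32 L²/|U| + (log N_p)/β`.
  Proof = the tight chord of Thm 3♯ at `U₁ = U/2` with the Langer–Mattis–Kennedy–Lieb floor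
  `E_L(U/2; 2m) ≥ Um/2 - 16L²/|U|` (`sectorEnergy_two_mul_ge_attractive`) tested on the Gibbs
  state as a BLOCK OPERATOR inequality (Gibbs positivity), and the thermal upper bracket
  `Re⟨H(U)⟩_β ≤ E₀(H(U)|_p) + (log N_p)/β ≤ Um + (log N_p)/β` (`re_gibbsState_self_le_groundEnergy_add`,
  paired trial configuration): with `k = ⟨-T⟩_β`, `d = ⟨D⟩_β ≥ 0`,
  `Um/2 - 16L²/|U| ≤ -k + (U/2)d` and `-k + Ud ≤ Um + (log N_p)/β` give `k ≤ 32L²/|U| + (log N_p)/β`.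
  The paper's Thm 8♯(v) compares FREE energies and pays the entropy twice (`2T log N_p`); the
  operator route pays it once.
* `thermalStiffness_mul_sq_le_attractive_sharp` — **Thm 8♯(ii) at `T > 0`**: if the
  `(2m, S^z = 0)` sector free energy of `hubbardTorusTT'Flux L 0 U θ` is stiff in the flux,
  `β ρ_s θ² ≤ log Z_p(0) - log Z_p(θ)` on `|θ| ≤ θ₀`, then `ρ_s L² ≤ 8 L²/|U| + (log N_p)/(4β)`
  (thermal f-sum floor `thermalStiffnessTT'_mul_sq_le_kinetic`, rotation averaging
  `two_mul_re_gibbsState_kinOpTT'_le`, and the kinetic ceiling above).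
* `ThermalAttractiveKineticCeilingSharp` / `…_holds`, `ThermalAttractiveStiffnessCeilingSharp` /
  `…_holds` — the displays as nodes (the stiffness node in the `δ`-form of the other stiffness
  nodes, `N_L = 2⌊(1-δ)L²/2⌋`, `δ ≥ -1`).

Honest numbers: `log N_p ≤ 2L² log 2`, so per site `ρ_s(T) ≤ 8t²/|U| + T (log 2)/2` (paper form
`8t²/|U| + T h(n/2)/2`); informative only for `|U| ≳ 20t` and `T ≲ t²/|U|`; the density-
proportional companion (`Bounds/ThermalAttractiveStiffnessCeiling.lean`, `32 n t²/|U| + …`) is the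
smaller one for `n < 1/4`. NK₂-conditional consequence (paper arithmetic, not typed):
`T_c ≤ 16t²/(|U|(8/π - h(n/2)))`, `≃ 8.63 t²/|U|` at `n = 1` (was `13.79`; below the
`T`-independent bathtub `T_c` ceiling of bounds.tex, Cor. `cor:Tc`, for `|U| ≳ 28t`, was `44t`).

References (`lean/references.bib`): the floor is the tree's
`hubbardTorus_groundEnergyAt_ge_lmClosed` / `sectorEnergy_two_mul_ge_attractive` (LangerMattis1971,
KennedyLieb1986 closed form; LiebPRL1989 for the attractive sector, as cited in
`Bounds/MottStiffnessCeiling.lean`, `Bounds/AttractiveStiffnessCeiling.lean`);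
ScalapinoWhiteZhang1993 §II; ParamekantiTrivediRanderia1998 eq. (3), §IV; HazraVermaRanderia2019
§III, App. G; MicnasRanningerRobaszkiewicz1990 §IV; Tasaki2020 §2.1.
-/

noncomputable section

namespace Summit.HubbardSuperconductivity.HubbardLadder.Bounds

open Matrix Finset Real
open Literature.MathematicalPhysics.QuantumLattice
open Literature.MathematicalPhysics.QuantumFieldTheory
open Literature.Probability.LatticeModels
open scoped ComplexOrder ComplexConjugate

/-! ### A sector ground-energy floor is a block operator inequality -/

/-- **Variational floor read in a sector Gibbs state.** For Hermitian `M` on the Fock space of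
`ι`, `E ≤ E₀(M; N)` (the `N`-particle variational ground energy `groundEnergy M N`), a non-empty
coordinate sector `p` of `N`-particle configurations and any `A` with `A|_p` Hermitian:
`E ≤ Re⟨M|_p⟩_{β, A|_p}` — `(M - E·1)|_p ≥ 0` (the homogeneous variational principle
`LiebThm1.groundEnergy_mul_norm_le` on extensions by zero of block vectors) and Gibbs positivity. -/
theorem le_re_gibbsState_toBlock_of_le_groundEnergy {ι : Type*} [LinearOrder ι] [Fintype ι]
    {M : Matrix (Finset ι) (Finset ι) ℂ} (hM : M.IsHermitian) {N : ℕ} {E : ℝ}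
    (hE : E ≤ Literature.MathematicalPhysics.QuantumLattice.groundEnergy M N)
    (p : Finset ι → Prop) [DecidablePred p] [Nonempty {a // p a}] (hpN : ∀ s, p s → s.card = N)
    {A : Matrix (Finset ι) (Finset ι) ℂ} (hA : (A.toBlock p p).IsHermitian) (β : ℝ) :
    E ≤ (gibbsState β (A.toBlock p p) (M.toBlock p p)).re := by
  set B : Matrix (Finset ι) (Finset ι) ℂ := M - (E : ℂ) • 1 with hB
  have hBh : B.IsHermitian := hM.sub (isHermitian_ofReal_smul isHermitian_one _)
  -- `B|_p ≥ 0`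
  have hpsd : (B.toBlock p p).PosSemidef := by
    refine PosSemidef.of_dotProduct_mulVec_nonneg (hBh.submatrix Subtype.val) fun φ => ?_
    set v : Fock ι := fun b => if h : p b then φ ⟨b, h⟩ else 0 with hv
    have hvsupp : ∀ b, ¬ p b → v b = 0 := fun b hb => by simp [hv, hb]
    have hφv : φ = fun a : {a // p a} => v a.1 := (restrict_extend p φ).symm
    have hN : IsNParticle N v := fun s hs => hvsupp s fun hps => hs (hpN s hps)
    have hray := LiebThm1.groundEnergy_mul_norm_le M hN
    unfold Literature.MathematicalPhysics.QuantumLattice.expect at hray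
    have hvv : 0 ≤ (star v ⬝ᵥ v).re := (Complex.nonneg_iff.1 (dotProduct_star_self_nonneg v)).1
    have hEv : E * (star v ⬝ᵥ v).re ≤ (star v ⬝ᵥ M *ᵥ v).re :=
      (mul_le_mul_of_nonneg_right hE hvv).trans hray
    have hform : star φ ⬝ᵥ B.toBlock p p *ᵥ φ = star v ⬝ᵥ B *ᵥ v := by
      rw [hφv]
      exact star_restrict_dotProduct_toBlock_mulVec p _ v hvsupp
    rw [hform]
    refine Complex.nonneg_iff.2 ⟨?_, (hBh.im_star_dotProduct_mulVec_self v).symm⟩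
    rw [hB, sub_mulVec, smul_mulVec, one_mulVec, dotProduct_sub, dotProduct_smul, Complex.sub_re,
      smul_eq_mul, Complex.re_ofReal_mul]
    linarith
  -- Gibbs positivity and `⟨1⟩ = 1`
  have hZ : partitionFn β (A.toBlock p p) ≠ 0 := fun h =>
    (partitionFn_re_pos hA β).ne' (by rw [h, Complex.zero_re])
  have h0 := gibbsState_nonneg_of_posSemidef β hA hpsd
  have hexp : B.toBlock p p = M.toBlock p p - (E : ℂ) • Matrix.toBlock 1 p p := by
    ext i j
    rfl
  rw [hexp, toBlock_one_self, map_sub, map_smul, gibbsState_one β _ hZ] at h0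
  have h1 := (Complex.nonneg_iff.1 h0).1
  rw [Complex.sub_re, smul_eq_mul, mul_one, Complex.ofReal_re] at h1
  linarith

/-- Arithmetic of the thermal tight chord at `U₁ = U/2`: the floor `Um/2 - 16X/|U| ≤ -k + (U/2)d`
and the ceiling `-k + Ud ≤ Um + ℓ` give `k ≤ 32X/|U| + ℓ` (the extensive terms cancel). -/
theorem kin_le_of_lm_brackets_arith {k d U m ℓ X : ℝ}
    (hlow : U / 2 * m - 16 * X / (-U) ≤ -k + U / 2 * d) (hup : -k + U * d ≤ U * m + ℓ) :
    k ≤ 32 * X / (-U) + ℓ := by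
  have e1 : U / 2 * d = U * d / 2 := by ring
  have e2 : U / 2 * m = U * m / 2 := by ring
  have e3 : 32 * X / (-U) = 2 * (16 * X / (-U)) := by ring
  rw [e1, e2] at hlow
  rw [e3]
  linarith

/-! ### Thm 8♯(v): the thermal kinetic ceiling `⟨-T⟩_{β,p} ≤ 32 L²/|U| + (log N_p)/β` -/

variable {L : ℕ} [NeZero L]

/-- **Thm 8♯(v), tree form** (`L ≥ 4` even — stated as `Even L`, `3 ≤ L` —, `U < 0`, `β > 0`,
`m ≤ L²`, `p` a coordinate sector of `2m`-particle configurations containing every paired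
configuration `A↑ ∪ A↓`, `#A = m`): `-Re⟨H(0)|_p⟩_{β,p} ≤ 32 L²/|U| + (log N_p)/β`. -/
theorem neg_re_gibbsState_hopping_le_attractive_sharp (hLe : Even L) (hL : 3 ≤ L) {U β : ℝ}
    (hU : U < 0) (hβ : 0 < β) {m : ℕ} (hm : m ≤ L ^ 2)
    (p : Finset (Orb (FermionTorus 2 L)) → Prop) [DecidablePred p] [Nonempty {a // p a}]
    (hpN : ∀ s, p s → s.card = 2 * m)
    (hpair : ∀ A : Finset (FermionTorus 2 L), A.card = m → p (pairSet A A)) :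
    -(gibbsState β ((hubbardTorusTT' L 1 0 U).toBlock p p)
        ((hubbardTorusTT' L 1 0 0).toBlock p p)).re ≤
      32 * (L : ℝ) ^ 2 / (-U) + Real.log (Fintype.card {a // p a}) / β := by
  set D : Matrix (Finset (Orb (FermionTorus 2 L))) (Finset (Orb (FermionTorus 2 L))) ℂ :=
    ∑ x : FermionTorus 2 L, numberOp x 0 * numberOp x 1 with hD
  set H := hubbardTorusTT' L 1 0 U with hH
  set H₀ := hubbardTorusTT' L 1 0 0 with hH₀
  have hHp : (H.toBlock p p).IsHermitian := (hubbardTorusTT'_isHermitian L 1 0 U).submatrix _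
  -- operator identities `H = H₀ + U D`, `H(U/2) = H₀ + (U/2) D`
  have hHU : H = H₀ + (U : ℂ) • D := by
    rw [hH, hH₀, hD, hubbardTorusTT'_eq_add_smul_doubleOcc 0 0 U, sub_zero]
  have hH2 : hubbardTorusTT' L 1 0 (U / 2) = H₀ + ((U / 2 : ℝ) : ℂ) • D := by
    rw [hH₀, hD, hubbardTorusTT'_eq_add_smul_doubleOcc 0 0 (U / 2), sub_zero]
  -- the two Gibbs quantities `k = ⟨-T⟩_β`, `d = ⟨D⟩_β ≥ 0`
  set k : ℝ := -(gibbsState β (H.toBlock p p) (H₀.toBlock p p)).re with hk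
  have hk' : (gibbsState β (H.toBlock p p) (H₀.toBlock p p)).re = -k := by rw [hk, neg_neg]
  set d : ℝ := (gibbsState β (H.toBlock p p) (D.toBlock p p)).re with hd
  have hd0 : 0 ≤ d := by
    have h := gibbsState_nonneg_of_posSemidef β hHp
      ((posSemidef_doubleOcc (L := L)).submatrix (Subtype.val : {a // p a} → _))
    exact (Complex.nonneg_iff.1 h).1
  -- (1) the thermal upper bracket `Re⟨H⟩_β ≤ U m + (log N_p)/β`
  have hup : -k + U * d ≤ U * m + Real.log (Fintype.card {a // p a}) / β := by
    have h1 := re_gibbsState_self_le_groundEnergy_add hHp hβ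
    have hcard : m ≤ (Finset.univ : Finset (FermionTorus 2 L)).card := by
      rw [Finset.card_univ, NoGo.card_fermionTorus_two]; exact hm
    obtain ⟨A, -, hA⟩ := Finset.exists_subset_card_eq hcard
    have hE0 : (H.toBlock p p).groundEnergy ≤ U * m := by
      have h := groundEnergy_toBlock_le_re_apply (hubbardTorusTT'_isHermitian L 1 0 U) p
        (pairSet A A) (hpair A hA)
      rw [re_hubbardTorusTT'_apply_pairSet, hA] at h
      exact h
    have hsplit : (gibbsState β (H.toBlock p p) (H.toBlock p p)).re = -k + U * d := by
      have e : H.toBlock p p = H₀.toBlock p p + (U : ℂ) • D.toBlock p p := by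
        conv_lhs => rw [hHU]
        ext i j
        rfl
      rw [congrArg (gibbsState β (H.toBlock p p)) e, map_add, map_smul, Complex.add_re, smul_eq_mul,
        Complex.re_ofReal_mul, hk', ← hd]
    linarith
  -- (2) the Langer–Mattis–Kennedy–Lieb floor at `U/2`, read in the Gibbs state
  have hfl : U / 2 * m - 16 * (L : ℝ) ^ 2 / (-U) ≤
      Literature.MathematicalPhysics.QuantumLattice.groundEnergy (hubbardTorusTT' L 1 0 (U / 2))
        (2 * m) := by
    have h := sectorEnergy_two_mul_ge_attractive hLe hL (U := U / 2) (by linarith) hm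
    rw [sectorEnergy_two_mul_eq_groundEnergyAt (U / 2) hm] at h
    have hU0 : U ≠ 0 := hU.ne
    have e : (8 : ℝ) * (L : ℝ) ^ 2 / (-(U / 2)) = 16 * (L : ℝ) ^ 2 / (-U) := by
      field_simp
      ring
    rw [e] at h
    rw [hubbardTorusTT'_zero]
    exact h
  have hlow : U / 2 * m - 16 * (L : ℝ) ^ 2 / (-U) ≤ -k + U / 2 * d := by
    -- (`convert` bridges the generic lemma's `ι`-derived decidability instances)
    have hge : U / 2 * m - 16 * (L : ℝ) ^ 2 / (-U) ≤
        (gibbsState β (H.toBlock p p) ((hubbardTorusTT' L 1 0 (U / 2)).toBlock p p)).re := by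
      convert le_re_gibbsState_toBlock_of_le_groundEnergy
        (hubbardTorusTT'_isHermitian L 1 0 (U / 2)) hfl p hpN hHp β
    have e : (hubbardTorusTT' L 1 0 (U / 2)).toBlock p p =
        H₀.toBlock p p + ((U / 2 : ℝ) : ℂ) • D.toBlock p p := by
      rw [hH2]
      ext i j
      rfl
    rw [e, map_add, map_smul, Complex.add_re, smul_eq_mul, Complex.re_ofReal_mul, hk', ← hd] at hge
    exact hge
  exact kin_le_of_lm_brackets_arith hlow hup

/-- **Thm 8♯(v) (thermal tight kinetic ceiling; PROVED below).** `L ≥ 4` even, `U < 0`, `β > 0`,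
`m ≤ L²`, `p` the `(2m, S^z = 0)` coordinate sector (`|s| = 2m`, `2 · #{i ∈ s : spin i = 0} = 2m`),
`N_p = dim p = binom(L², m)²`: the sector Gibbs state of the attractive Hubbard torus has
`⟨-T⟩_{β,p} = -Re⟨H(0)|_p⟩_{β,p} ≤ 32 L²/|U| + (log N_p)/β` (one entropy term). kind: support
(PROVED). Why it might fail: it cannot; informative only for `|U| ≳ 20` and `T ≲ t²/|U|`.
Sources: MicnasRanningerRobaszkiewicz1990 §IV; HazraVermaRanderia2019 App. G; this cell
(Thm 3♯, 8♯). -/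
@[conjecture] def ThermalAttractiveKineticCeilingSharp : Prop :=
  ∀ (L : ℕ) [NeZero L], Even L → 3 ≤ L → ∀ (U β : ℝ) (m : ℕ), U < 0 → 0 < β → m ≤ L ^ 2 →
    let p : Finset (Orb (FermionTorus 2 L)) → Prop := fun s =>
      s.card = 2 * m ∧ 2 * (s.filter fun i => (ofLex i).2 = 0).card = 2 * m
    (-(gibbsState β ((hubbardTorusTT' L 1 0 U).toBlock p p)
        ((hubbardTorusTT' L 1 0 0).toBlock p p)).re) ≤
      32 * (L : ℝ) ^ 2 / (-U) + Real.log (Fintype.card {s // p s}) / β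

/-- **`ThermalAttractiveKineticCeilingSharp` holds.** -/
theorem thermalAttractiveKineticCeilingSharp_holds : ThermalAttractiveKineticCeilingSharp := by
  intro L _ hLe hL U β m hU hβ hm
  dsimp only
  set p : Finset (Orb (FermionTorus 2 L)) → Prop := fun s =>
    s.card = 2 * m ∧ 2 * (s.filter fun i => (ofLex i).2 = 0).card = 2 * m with hp
  haveI : Nonempty {a // p a} := nonempty_spinZeroSector (L := L) hm
  exact neg_re_gibbsState_hopping_le_attractive_sharp hLe hL hU hβ hm p (fun s hs => hs.1)
    (fun A hA => pairSet_mem_spinZeroSector A hA)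

/-! ### Thm 8♯(ii) at `T > 0`: the thermal tight stiffness ceiling -/

/-- **Thm 8♯(ii) at `T > 0`** (`L ≥ 4` even, `U < 0`, `β, ρ_s, θ₀ > 0`, `m ≤ L²`, `p` the
`(2m, S^z = 0)` coordinate sector, `N_p = dim p`): if the sector free energy of
`hubbardTorusTT'Flux L 0 U θ` is stiff in the flux, `β ρ_s θ² ≤ log Z_p(0) - log Z_p(θ)` on
`|θ| ≤ θ₀`, then `ρ_s L² ≤ 8 L²/|U| + (log N_p)/(4β)`. -/
theorem thermalStiffness_mul_sq_le_attractive_sharp (hLe : Even L) (hL : 3 ≤ L) {U β ρs θ₀ : ℝ}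
    (hU : U < 0) (hβ : 0 < β) (hρs : 0 < ρs) (hθ₀ : 0 < θ₀) {m : ℕ} (hm : m ≤ L ^ 2)
    (hstiff : ∀ θ : ℝ, |θ| ≤ θ₀ → β * ρs * θ ^ 2 ≤
      Real.log (partitionFn β ((hubbardTorusTT'Flux L 0 U 0).toBlock
        (fun s : Finset (Orb (FermionTorus 2 L)) =>
          s.card = 2 * m ∧ 2 * (s.filter fun i => (ofLex i).2 = 0).card = 2 * m)
        (fun s => s.card = 2 * m ∧ 2 * (s.filter fun i => (ofLex i).2 = 0).card = 2 * m))).re -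
      Real.log (partitionFn β ((hubbardTorusTT'Flux L 0 U θ).toBlock
        (fun s : Finset (Orb (FermionTorus 2 L)) =>
          s.card = 2 * m ∧ 2 * (s.filter fun i => (ofLex i).2 = 0).card = 2 * m)
        (fun s => s.card = 2 * m ∧ 2 * (s.filter fun i => (ofLex i).2 = 0).card = 2 * m))).re) :
    ρs * (L : ℝ) ^ 2 ≤ 8 * (L : ℝ) ^ 2 / (-U) +
      Real.log (Fintype.card {s : Finset (Orb (FermionTorus 2 L)) //
        s.card = 2 * m ∧ 2 * (s.filter fun i => (ofLex i).2 = 0).card = 2 * m}) / (4 * β) := by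
  set p : Finset (Orb (FermionTorus 2 L)) → Prop := fun s =>
    s.card = 2 * m ∧ 2 * (s.filter fun i => (ofLex i).2 = 0).card = 2 * m with hp
  haveI : Nonempty {a // p a} := nonempty_spinZeroSector (L := L) hm
  have hfloor := thermalStiffnessTT'_mul_sq_le_kinetic hL 0 U hβ hρs hθ₀ p hstiff
  have hrot := two_mul_re_gibbsState_kinOpTT'_le hL 0 U β p
    (fun s t h => sector_iff_of_fockMapOp_rot_ne_zero _ h)
  rw [mul_zero] at hrot
  have hkin := neg_re_gibbsState_hopping_le_attractive_sharp hLe hL hU hβ hm p (fun s hs => hs.1)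
    (fun A hA => pairSet_mem_spinZeroSector A hA)
  have e : 8 * (L : ℝ) ^ 2 / (-U) + Real.log (Fintype.card {a // p a}) / (4 * β) =
      (32 * (L : ℝ) ^ 2 / (-U) + Real.log (Fintype.card {a // p a}) / β) / 4 := by
    field_simp
    ring
  rw [e]
  linarith

/-- **Thm 8♯(ii) at `T > 0` (thermal tight stiffness ceiling; PROVED below).** `L ≥ 4` even,
`U < 0`, `δ ≥ -1`, `β, ρ_s, θ₀ > 0`, `N_L = 2⌊(1-δ)L²/2⌋`, `p` the `(N_L, S^z = 0)` coordinate
sector, `N_p = dim p`: if the sector free energy of `hubbardTorusTT'Flux L 0 U θ` (pure Hubbard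
torus, `x`-seam twist) is stiff in the flux, `β ρ_s θ² ≤ log Z_p(0) - log Z_p(θ)` on `|θ| ≤ θ₀`,
then `ρ_s L² ≤ 8 L²/|U| + (log N_p)/(4β)`, i.e. `ρ_s ≤ 8 t²/|U| + T log N_p/(4L²) ≤
8 t²/|U| + T h(n/2)/2`. At `T → 0` it is the landed Thm 8♯(ii) (`AttractiveStiffnessCeilingSharp`,
`ρ_s ≤ 8t²/|U|`). kind: support (PROVED). Why it might fail: it cannot; informative only for
`|U| ≳ 20 t`, `T ≲ t²/|U|`. Sources: ScalapinoWhiteZhang1993 §II; ParamekantiTrivediRanderia1998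
eq. (3); HazraVermaRanderia2019 §III, App. G; this cell (Thm 3♯, 8♯). -/
@[conjecture] def ThermalAttractiveStiffnessCeilingSharp : Prop :=
  ∀ (L : ℕ) [NeZero L], Even L → 3 ≤ L → ∀ (U δ β ρs θ₀ : ℝ), U < 0 → -1 ≤ δ → 0 < β → 0 < ρs →
    0 < θ₀ →
    let p : Finset (Orb (FermionTorus 2 L)) → Prop := fun s =>
      s.card = 2 * ⌊(1 - δ) * (L : ℝ) ^ 2 / 2⌋₊ ∧
        2 * (s.filter fun i => (ofLex i).2 = 0).card = 2 * ⌊(1 - δ) * (L : ℝ) ^ 2 / 2⌋₊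
    (∀ θ : ℝ, |θ| ≤ θ₀ → β * ρs * θ ^ 2 ≤
        Real.log (partitionFn β ((hubbardTorusTT'Flux L 0 U 0).toBlock p p)).re -
          Real.log (partitionFn β ((hubbardTorusTT'Flux L 0 U θ).toBlock p p)).re) →
    ρs * (L : ℝ) ^ 2 ≤ 8 * (L : ℝ) ^ 2 / (-U) + Real.log (Fintype.card {s // p s}) / (4 * β)

/-- **`ThermalAttractiveStiffnessCeilingSharp` holds.** -/
theorem thermalAttractiveStiffnessCeilingSharp_holds : ThermalAttractiveStiffnessCeilingSharp := by
  intro L _ hLe hL U δ β ρs θ₀ hU hδ hβ hρs hθ₀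
  dsimp only; intro hst
  exact thermalStiffness_mul_sq_le_attractive_sharp hLe hL hU hβ hρs hθ₀
    (NoGo.floor_pairNumber_le δ hδ L) hst

end Summit.HubbardSuperconductivity.HubbardLadder.Bounds

end
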